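import Mathlib
import Literature.MathematicalPhysics.QuantumFieldTheory.Borinsky2020.TropicalApproximation
import HarnessLib

/-!
# Volkov's ray criterion for the absolute convergence of integrals of fractional-rational functions (ЖЭТФ 149 (2016) 1164 = JETP 122 (2016) 1008, §5.1 Утверждение 1 / Proposition 1, proof Appendix A) — PROVED, together with its tropical (exponent) form

independent recomputation; certified where stated, statistical where stated; no new-physics claim.

CITATION HEADER (venture `QEDPrecision`, cell `pub-qed`, track TROPICAL seat V3a = `pub-qed-trop-v3-lit-1` gen 9; VALUE-FREE:
a real-analysis statement about ABSTRACT quotients of polynomials / finite exponent sets — no Feynman graph, no constant of Volkov's, no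
integral of any graph is evaluated, nothing per Set V family or word). Serves `tropical/view/V3-VOLKOV-DEGREES.md` §A A.4.2 (the
convergence argument of the subtraction construction AS PRINTED), A.0.3 / A.0.7 (the dictionary line "mean finite ⇐ exponent > 0 on all
rays — V16 Утв. 1 is the multi-ray form") and A.8's «V2» line ("Volkov's own convergence test IS a ray probe"): it makes the printed
criterion — the provenance of the track's numerical SECTOR-PROBE (ray probe) (VIEW item V2) and of the finite-MEAN half of the oracle's reading —
a kernel theorem, and isolates the purely tropical statement behind it (finite exponent sets, any tropically bounded denominator).

Source [Volkov2016]: С. А. Волков, «Вычитательная процедура для вычисления аномального магнитного момента электрона в КЭД и её применение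
для численного расчёта на трёхпетлевом уровне», ЖЭТФ 149 (6) 1164–1191 (2016) = S. A. Volkov, J. Exp. Theor. Phys. 122 (6) 1008–1031
(2016), doi 10.1134/S1063776116050113 (the FULL version of arXiv:1507.06435). Russian original held by the cell (HOME
`data/lit/sources/.cache/zhetf149_1164_Volkov2016/r_149_1164.pdf`, per-page text `…/journal-pdf-pages/ZhETF149-1164-Volkov2016/pNNNN.txt`,
PDF page N = journal page 1163 + N; locators below are «journal page : pNN line»). VERBATIM, §5.1, journal p.1175 = p12 L43–L58:
«Утверждение 1. Пусть I(z₁,…,z_n) есть частное двух полиномов, знаменатель которого имеет положительные коэффициенты. Тогда если для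
любого вектора из неотрицательных чисел β = (β₁,…,β_n), такого что β₁ + … + β_n > 0, и для функций z₁(δ),…,z_n(δ), определенных при
δ > 0 и принимающих значения на (0;1], таких что z₁ ≍ δ^{β₁}, …, z_n ≍ δ^{β_n} (19) при δ → 0 [сноска 16: f(δ) ≍ g(δ) означает, что
0 < C₁ < |f(δ)/g(δ)| < C₂ в некоторой окрестности предельного значения δ], имеет место соотношение I(z₁(δ),…,z_n(δ)) z₁(δ)…z_n(δ) → 0, (20)
то интеграл ∫₀¹ |I(z₁,…,z_n)| dz₁…dz_n конечен. Доказательство этого утверждения дано в Приложении A.» ⟦Proposition 1. Let I be a quotient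
of two polynomials whose denominator has positive coefficients. If for every vector of non-negative numbers β with Σβ > 0 and for all
functions z_i(δ), defined for δ > 0 with values in (0;1] and z_i ≍ δ^{β_i} as δ → 0 (f ≍ g: 0 < C₁ < |f/g| < C₂ near the limit), one has
I(z(δ))·z₁(δ)⋯z_n(δ) → 0, then ∫_{[0,1]ⁿ} |I| dz is finite.⟧ — followed (p12 L61–L71) by the simplex proviso «…поэтому данный признак можно
использовать и для этих интегралов [вида (16), с δ(Σz − 1)], с оговоркой, что одно из чисел β_q обязательно должно быть равно нулю»
and the scope sentence (L72–L80) «мы не будем доказывать, что соотношение (20) выполняется всегда для любых β … для любого графа Фейнмана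
(это представляется очень трудоемким)». PROOF, Приложение A «Доказательство признака сходимости интегралов от дробно-рациональных
функций (утверждения 1)», journal p.1185 = p22 L34–L124, VERBATIM in outline: «Сделаем замену переменных z_q = exp(−y_q), тогда
рассматриваемый интеграл можно переписать в форме ∫₀^∞ |C₁ exp(l₁y) + … + C_h exp(l_h y)| / (D₁ exp(s₁y) + … + D_p exp(s_p y)) dy₁…dy_n,
где l₁,…,l_h — различные векторы, s₁,…,s_p — тоже различные векторы, C₁,…,C_h ≠ 0, D₁,…,D_p > 0. Положим Φ_j = {y : y₁,…,y_n ≥ 0,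
(∀q ≠ j) s_j y ≥ s_q y}. Предположим, что рассматриваемый интеграл расходится, тогда он расходится и на одном из невырожденных множеств
Φ_j … Тогда, очевидно, множество Φ_j содержит некоторый луч с направлением r, таким что для некоторого q: (l_q − s_j) r ≥ 0. Далее,
выберем все q, для которых произведение (l_q − s_j) r максимально, пусть для определенности, это 1, 2, …, H. Выберем такое y⁰, что
C₁ exp((l₁ − s_j) y⁰) + … + C_H exp((l_H − s_j) y⁰) ≠ 0 (такое значение существует, так как все l₁,…,l_H различны, а Φ_j невырождено).
… поэтому можно положить β = r, z_q(δ) = exp(−y⁰_q) δ^{r_q} и получить противоречие с условием утверждения.»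

ARCHITECTURE OF THIS FILE (the printed proof, run DIRECTLY instead of by contradiction; deviations named):
* §1 the tropical layer (finite exponent sets `A` (numerator) and `B` (denominator) of real vectors; `rayExp A B β` =
  `min_{p∈A}⟨p,β⟩ + Σβ − min_{q∈B}⟨q,β⟩` is the exponent of `(max_A z^p · Πz)/max_B z^q` along `z = δ^β` — App. A's vectors are
  `l = −(p + 𝟙)`, `s = −q` after `z = e^{−y}`). App. A's «очевидно, Φ_j содержит луч r с (l_q − s_j)·r ≥ 0» is, contrapositively, the
  statement that positivity of the (continuous, positively homogeneous) exponent function on the non-negative orthant ∖ 0 gives a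
  UNIFORM bound `rayExp β ≥ ε Σβ` (`exists_uniform_rayExp`: minimum over Mathlib's compact `stdSimplex`); with it the regions Φ_j are not
  needed: on the open cube `max_A x^p / max_B x^q ≤ Π_i x_i^{ε−1}` (`tropMax_div_le_prod_rpow`, the substitution u = −log x of App. A done
  pointwise), which is integrable (`integrableOn_prod_rpow`, Mathlib's `Integrable.fintype_prod` + `intervalIntegrable_rpow'`) — whence
  **`integrableOn_tropMax_div`**, the tropical ray criterion, and `integrableOn_of_le_tropMax_div` for any measurable function so bounded
  (usable with ANY denominator bounded below by a constant times its tropical maximum — positive coefficients as printed, or e.g. a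
  completely non-vanishing one in the sense of `Borinsky2020/TropicalApproximation.lean`, Thm 8b there; that file's `trop`/`monom` are the
  natural-exponent polynomial case of `tropMax`/`rmonom` here — §4 below is the dictionary).
* §2 the polynomial layer: `rayOrder P β = min_{supp P}⟨p,β⟩`, `rayExponent P Q β`; `|P| ≤ (Σ|coeff|)·max` and `Q ≥ (min coeff)·max` for a
  positive-coefficient `Q` give **`integrableOn_div_of_rayExponent_pos`** — the criterion in EXPONENT form (Newton-polytope data only).
* §3 from the printed RAY hypothesis to the exponent condition = the remainder of App. A: the initial form `initForm R β` (App. A's «все q, для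
  которых (l_q − s_j)·r максимально»), the generic point «такое y⁰ существует» = `exists_eval_ne_zero_of_ne_zero` (Mathlib's
  combinatorial-Nullstellensatz lemma `MvPolynomial.eq_zero_of_eval_zero_at_prod_finset` on a grid inside (0,1)ⁿ), the leading asymptotics
  `δ^{−m_R(β)} R(c δ^β) → R_β(c)` (`tendsto_rpow_neg_rayOrder_mul_eval`), and App. A's final contradiction along `z_q(δ) = e^{−y⁰_q} δ^{r_q}`
  (`rayExponent_pos_of_tendsto_zero`). Hence **`integrableOn_div_of_tendsto_zero_along_rays`** — Утв. 1 with the hypothesis demanded ONLY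
  on the monomial paths `z_i = c_i δ^{β_i}`, `c ∈ (0,1)ⁿ` (a STRONGER theorem than printed) — and **`integrableOn_div_of_isTheta_paths`** /
  **`integrableOn_Icc_div_of_isTheta_paths`** = Утв. 1 VERBATIM (all paths with values in (0;1] and `z_i =Θ[𝓝[>]0] δ^{β_i}`, Mathlib's
  `Asymptotics.IsTheta` being footnote 16's `≍`; conclusion on the open resp. closed unit cube, which differ by a null set).
* §4 dictionary with `Borinsky2020/TropicalApproximation.lean` (arXiv:2008.12310 Defs 1, 2, 6): on a non-zero polynomial's exponent set
  `tropMax` IS Borinsky's `trop` (`tropMax_exps_eq_trop`), Borinsky's face value at `−β` is `−rayOrder` (`faceValue_neg_eq`), and Volkov's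
  initial form along `β` IS Borinsky's truncation to the face exposed by `−β` (`initForm_eq_trunc`) — App. A's top group «1, …, H» = the face
  of the Newton polytope minimising `⟨·, β⟩`.
TYPING. `I = P/Q` with `P Q : MvPolynomial (Fin n) ℝ`, "denominator with positive coefficients" = `∀ q ∈ Q.support, 0 < Q.coeff q`;
"∫₀¹ |I| dz₁…dz_n конечен" = `IntegrableOn (fun x => eval x P / eval x Q) _ volume` (⇔ measurable with ∫⁻|I| < ∞). JUNK VALUES (documented,
harmless): for `Q = 0` Lean's `x / 0 = 0` makes every conclusion trivially true (the printed statement presupposes a genuine denominator);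
`rayOrder 0 β = 0`. NOT typed: the simplex proviso (integrals «вида (16)» with δ(Σz − 1)); necessity of the exponent condition (true for the
tropical majorant, not printed); anything about denominators WITHOUT positive coefficients such as the on-shell `W = S − V z_e` of §5.1 (their
lower bounds are V20 = NPB 961 115232 Lemma 4's business); §5–§6's applications of Утв. 1 to specific β-vectors (A.4.2 / A.14–A.15 of the
V3 notes quote them). 0 named facts (D-0026): every declaration below is a definition with a body or a proved theorem.
-/

noncomputable section

open MeasureTheory Set Filter
open scoped Topology

namespace Literature.MathematicalPhysics.QuantumFieldTheory.Volkov2016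

variable {n : ℕ}

/-! ### §1 The tropical layer: finite exponent sets -/

/-- The pairing `⟨p, β⟩ = Σ_i p_i β_i` of an exponent vector with a ray direction (App. A's `l·y`, `s·y`).
[cite: Volkov2016, App. A (p.1185)] -/
def linPair (p β : Fin n → ℝ) : ℝ := ∑ i, p i * β i

/-- The open unit cube `(0,1)ⁿ` of Feynman parameters (the closed cube of the printed `∫₀¹ … dz₁…dz_n` up to a
null set, `unitCube_ae_eq_Icc`). [cite: Volkov2016, §5.1 Утв. 1 (p.1175)] -/
def unitCube (n : ℕ) : Set (Fin n → ℝ) := Set.pi Set.univ fun _ => Set.Ioo (0 : ℝ) 1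

/-- The real-exponent monomial `x^p = Π_i x_i^{p_i}` (`= exp(l·y)`-type term of App. A after `z = e^{−y}`). [folklore] -/
def rmonom (p x : Fin n → ℝ) : ℝ := ∏ i, x i ^ p i

/-- The tropical maximum `max_{p ∈ A} x^p` of a non-empty finite exponent set. [folklore] -/
def tropMax (A : Finset (Fin n → ℝ)) (hA : A.Nonempty) (x : Fin n → ℝ) : ℝ :=
  A.sup' hA fun p => rmonom p x

/-- The tropical order `min_{p ∈ A} ⟨p, β⟩` of a non-empty finite exponent set along the ray `β`
(the order in `δ` of `max_A z^p` along `z = δ^β`). [folklore] -/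
def tropOrd (A : Finset (Fin n → ℝ)) (hA : A.Nonempty) (β : Fin n → ℝ) : ℝ :=
  A.inf' hA fun p => linPair p β

/-- Volkov's ray exponent of `(max_A z^p · z₁⋯z_n) / max_B z^q` along `z = δ^β`:
`min_A⟨p,β⟩ + Σβ − min_B⟨q,β⟩` (App. A: `−max_q (l_q − s_j)·r` on the region where `s_j` dominates).
[cite: Volkov2016, App. A (p.1185)] -/
def rayExp (A B : Finset (Fin n → ℝ)) (hA : A.Nonempty) (hB : B.Nonempty) (β : Fin n → ℝ) : ℝ :=
  tropOrd A hA β + ∑ i, β i - tropOrd B hB β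

/-- `⟨p, tβ⟩ = t⟨p, β⟩`. [folklore] -/
private theorem linPair_smul (p β : Fin n → ℝ) (t : ℝ) : linPair p (t • β) = t * linPair p β := by
  simp only [linPair, Pi.smul_apply, smul_eq_mul, Finset.mul_sum]
  exact Finset.sum_congr rfl fun i _ => by ring

/-- `⟨p, 0⟩ = 0`. [folklore] -/
private theorem linPair_zero (p : Fin n → ℝ) : linPair p 0 = 0 := by
  simp [linPair]

/-- `min_a (t · g a) = t · min_a g a` for `t ≥ 0`. [folklore] -/
private theorem inf'_const_mul {ι : Type*} (s : Finset ι) (hs : s.Nonempty) (g : ι → ℝ) {t : ℝ}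
    (ht : 0 ≤ t) : s.inf' hs (fun a => t * g a) = t * s.inf' hs g := by
  obtain ⟨a, ha, hmin⟩ := Finset.exists_mem_eq_inf' hs g
  refine le_antisymm ?_ ?_
  · rw [hmin]; exact Finset.inf'_le _ ha
  · exact Finset.le_inf' _ _ fun b hb => mul_le_mul_of_nonneg_left (Finset.inf'_le _ hb) ht

/-- Positive homogeneity of the tropical order. [folklore] -/
private theorem tropOrd_smul (A : Finset (Fin n → ℝ)) (hA : A.Nonempty) (β : Fin n → ℝ) {t : ℝ}
    (ht : 0 ≤ t) : tropOrd A hA (t • β) = t * tropOrd A hA β := by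
  simp only [tropOrd, linPair_smul]
  exact inf'_const_mul A hA _ ht

/-- `tropOrd A 0 = 0`. [folklore] -/
private theorem tropOrd_zero (A : Finset (Fin n → ℝ)) (hA : A.Nonempty) : tropOrd A hA 0 = 0 := by
  simp [tropOrd, linPair_zero]

/-- Positive homogeneity of the ray exponent (App. A works with ray DIRECTIONS `r`). [cite: Volkov2016, App. A (p.1185)] -/
private theorem rayExp_smul (A B : Finset (Fin n → ℝ)) (hA : A.Nonempty) (hB : B.Nonempty)
    (β : Fin n → ℝ) {t : ℝ} (ht : 0 ≤ t) :
    rayExp A B hA hB (t • β) = t * rayExp A B hA hB β := by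
  simp only [rayExp, tropOrd_smul _ _ _ ht, Pi.smul_apply, smul_eq_mul, ← Finset.mul_sum]
  ring

/-- `rayExp 0 = 0`. [folklore] -/
private theorem rayExp_zero (A B : Finset (Fin n → ℝ)) (hA : A.Nonempty) (hB : B.Nonempty) :
    rayExp A B hA hB 0 = 0 := by
  simp [rayExp, tropOrd_zero]

/-- The tropical order is continuous in the direction. [folklore] -/
private theorem continuous_tropOrd (A : Finset (Fin n → ℝ)) (hA : A.Nonempty) :
    Continuous (tropOrd A hA) := by
  unfold tropOrd linPair
  exact Continuous.finset_inf'_apply hA fun p _ =>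
    continuous_finsetSum _ fun i _ => continuous_const.mul (continuous_apply i)

/-- The ray exponent is continuous in the direction. [folklore] -/
private theorem continuous_rayExp (A B : Finset (Fin n → ℝ)) (hA : A.Nonempty) (hB : B.Nonempty) :
    Continuous (rayExp A B hA hB) := by
  unfold rayExp
  exact ((continuous_tropOrd A hA).add (continuous_finsetSum _ fun i _ => continuous_apply i)).sub
    (continuous_tropOrd B hB)

/-- **App. A's «очевидно» step, contrapositive and uniform**: if the ray exponent is positive at every non-zero `β ≥ 0`
then `rayExp β ≥ ε Σβ` for some `ε > 0` (minimum of the continuous, positively homogeneous `rayExp` over Mathlib's compact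
`stdSimplex`; for `n = 0` any `ε` works). [cite: Volkov2016, App. A (p.1185), «множество Φ_j содержит некоторый луч с направлением r…»] -/
theorem exists_uniform_rayExp (A B : Finset (Fin n → ℝ)) (hA : A.Nonempty) (hB : B.Nonempty)
    (hpos : ∀ β : Fin n → ℝ, (∀ i, 0 ≤ β i) → β ≠ 0 → 0 < rayExp A B hA hB β) :
    ∃ ε : ℝ, 0 < ε ∧ ∀ β : Fin n → ℝ, (∀ i, 0 ≤ β i) → ε * ∑ i, β i ≤ rayExp A B hA hB β := by
  rcases isEmpty_or_nonempty (Fin n) with hn | hn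
  · refine ⟨1, one_pos, fun β hβ => ?_⟩
    have hβ0 : β = 0 := funext fun i => isEmptyElim i
    subst hβ0
    simp [rayExp_zero]
  · obtain ⟨i₀⟩ := hn
    have hne : (stdSimplex ℝ (Fin n)).Nonempty := ⟨_, ite_eq_mem_stdSimplex ℝ i₀⟩
    obtain ⟨β₀, hβ₀, hmin⟩ := (isCompact_stdSimplex ℝ (Fin n)).exists_isMinOn hne
      (continuous_rayExp A B hA hB).continuousOn
    have hβ₀ne : β₀ ≠ 0 := by
      intro h
      have := hβ₀.2
      simp [h] at this
    refine ⟨rayExp A B hA hB β₀, hpos β₀ hβ₀.1 hβ₀ne, fun β hβ => ?_⟩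
    set t : ℝ := ∑ i, β i with ht
    have ht0 : 0 ≤ t := Finset.sum_nonneg fun i _ => hβ i
    rcases ht0.eq_or_lt with ht0 | htpos
    · have hβ0 : β = 0 := by
        funext i
        exact (Finset.sum_eq_zero_iff_of_nonneg fun i _ => hβ i).1 ht0.symm i (Finset.mem_univ i)
      subst hβ0
      simp [rayExp_zero, ← ht0]
    · have hmem : t⁻¹ • β ∈ stdSimplex ℝ (Fin n) := by
        refine ⟨fun i => ?_, ?_⟩
        · simpa using mul_nonneg (inv_nonneg.2 htpos.le) (hβ i)
        · simp only [Pi.smul_apply, smul_eq_mul, ← Finset.mul_sum]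
          exact inv_mul_cancel₀ htpos.ne'
      have h1 : rayExp A B hA hB β₀ ≤ rayExp A B hA hB (t⁻¹ • β) := hmin hmem
      have h2 : rayExp A B hA hB β = t * rayExp A B hA hB (t⁻¹ • β) := by
        rw [← rayExp_smul A B hA hB _ htpos.le, smul_smul, mul_inv_cancel₀ htpos.ne', one_smul]
      rw [h2, mul_comm]
      exact mul_le_mul_of_nonneg_left h1 htpos.le


/-- Membership in the open unit cube of Feynman parameters. [cite: Volkov2016, §5.1 Утв. 1 (p.1175), the domain of ∫₀¹…dz₁…dz_n] -/
theorem mem_unitCube {x : Fin n → ℝ} : x ∈ unitCube n ↔ ∀ i, 0 < x i ∧ x i < 1 := by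
  simp [unitCube, Set.mem_pi, Set.mem_Ioo]

/-- The open unit cube is measurable. [folklore] -/
private theorem measurableSet_unitCube : MeasurableSet (unitCube n) :=
  MeasurableSet.univ_pi fun _ => measurableSet_Ioo

/-- App. A's substitution `z_q = exp(−y_q)` pointwise: on the positive orthant `x^p = exp(−⟨p, u⟩)` with `u = −log x`.
[cite: Volkov2016, App. A (p.1185), «Сделаем замену переменных z_q = exp(−y_q)»] -/
theorem rmonom_eq_exp {x : Fin n → ℝ} (hx : ∀ i, 0 < x i) (p : Fin n → ℝ) :
    rmonom p x = Real.exp (-linPair p fun i => -Real.log (x i)) := by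
  simp only [rmonom, linPair, mul_neg, Finset.sum_neg_distrib, neg_neg, Real.exp_sum]
  exact Finset.prod_congr rfl fun i _ => by rw [Real.rpow_def_of_pos (hx i), mul_comm]

/-- `x^p > 0` on the positive orthant. [folklore] -/
private theorem rmonom_pos {x : Fin n → ℝ} (hx : ∀ i, 0 < x i) (p : Fin n → ℝ) : 0 < rmonom p x := by
  rw [rmonom_eq_exp hx]; exact Real.exp_pos _

/-- `max_A x^p > 0` on the positive orthant. [folklore] -/
private theorem tropMax_pos (A : Finset (Fin n → ℝ)) (hA : A.Nonempty) {x : Fin n → ℝ}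
    (hx : ∀ i, 0 < x i) : 0 < tropMax A hA x := by
  obtain ⟨p, hp⟩ := hA
  exact lt_of_lt_of_le (rmonom_pos hx p) (Finset.le_sup' (fun p => rmonom p x) hp)

/-- `max_A x^p ≤ exp(−min_A ⟨p,u⟩)`, `u = −log x`. [folklore] -/
private theorem tropMax_le_exp (A : Finset (Fin n → ℝ)) (hA : A.Nonempty) {x : Fin n → ℝ}
    (hx : ∀ i, 0 < x i) :
    tropMax A hA x ≤ Real.exp (-tropOrd A hA fun i => -Real.log (x i)) := by
  refine Finset.sup'_le hA _ fun p hp => ?_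
  rw [rmonom_eq_exp hx]
  exact Real.exp_le_exp.2 (neg_le_neg (Finset.inf'_le _ hp))

/-- `exp(−min_B ⟨q,u⟩) ≤ max_B x^q`, `u = −log x`. [folklore] -/
private theorem exp_le_tropMax (B : Finset (Fin n → ℝ)) (hB : B.Nonempty) {x : Fin n → ℝ}
    (hx : ∀ i, 0 < x i) :
    Real.exp (-tropOrd B hB fun i => -Real.log (x i)) ≤ tropMax B hB x := by
  obtain ⟨q, hq, hqeq⟩ := Finset.exists_mem_eq_inf' hB fun q => linPair q fun i => -Real.log (x i)
  unfold tropOrd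
  rw [hqeq, ← rmonom_eq_exp hx]
  exact Finset.le_sup' (fun q => rmonom q x) hq

/-- The pointwise tropical bound on the open unit cube: if `ε Σβ ≤ rayExp β` on the non-negative orthant then
`max_A x^p / max_B x^q ≤ Π_i x_i^{ε−1}` (apply the hypothesis to `β = u = −log x`). [cite: Volkov2016, App. A (p.1185)] -/
theorem tropMax_div_le_prod_rpow (A B : Finset (Fin n → ℝ)) (hA : A.Nonempty) (hB : B.Nonempty)
    {ε : ℝ} (hε : ∀ β : Fin n → ℝ, (∀ i, 0 ≤ β i) → ε * ∑ i, β i ≤ rayExp A B hA hB β)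
    {x : Fin n → ℝ} (hx : x ∈ unitCube n) :
    tropMax A hA x / tropMax B hB x ≤ ∏ i, x i ^ (ε - 1) := by
  rw [mem_unitCube] at hx
  have hx0 : ∀ i, 0 < x i := fun i => (hx i).1
  set u : Fin n → ℝ := fun i => -Real.log (x i) with hu
  have hu0 : ∀ i, 0 ≤ u i := fun i => neg_nonneg.2 (Real.log_nonpos (hx0 i).le (hx i).2.le)
  have hεu := hε u hu0
  calc tropMax A hA x / tropMax B hB x
      ≤ Real.exp (-tropOrd A hA u) / Real.exp (-tropOrd B hB u) :=
        div_le_div₀ (Real.exp_pos _).le (tropMax_le_exp A hA hx0) (Real.exp_pos _)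
          (exp_le_tropMax B hB hx0)
    _ = Real.exp (∑ i, u i - rayExp A B hA hB u) := by
        rw [← Real.exp_sub]; congr 1; simp only [rayExp]; ring
    _ ≤ Real.exp (∑ i, (1 - ε) * u i) := by
        refine Real.exp_le_exp.2 ?_
        rw [← Finset.mul_sum]; linarith
    _ = ∏ i, x i ^ (ε - 1) := by
        rw [Real.exp_sum]
        exact Finset.prod_congr rfl fun i _ => by
          rw [Real.rpow_def_of_pos (hx0 i)]; congr 1; simp only [hu]; ring

/-- `Π_i x_i^{ε−1}` is integrable on the open unit cube for `ε > 0` (product of one-dimensional `∫₀¹ t^{ε−1} dt = 1/ε`). [folklore] -/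
private theorem integrableOn_prod_rpow {ε : ℝ} (hε : 0 < ε) :
    IntegrableOn (fun x : Fin n → ℝ => ∏ i, x i ^ (ε - 1)) (unitCube n) volume := by
  have h1 : IntegrableOn (fun t : ℝ => t ^ (ε - 1)) (Set.Ioo 0 1) volume :=
    (intervalIntegrable_iff_integrableOn_Ioo_of_le zero_le_one).1
      (intervalIntegral.intervalIntegrable_rpow' (by linarith))
  have hμ : (volume : Measure (Fin n → ℝ)).restrict (unitCube n)
      = Measure.pi fun _ : Fin n => (volume : Measure ℝ).restrict (Set.Ioo 0 1) := by
    rw [volume_pi, unitCube, Measure.restrict_pi_pi]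
  rw [IntegrableOn, hμ]
  exact Integrable.fintype_prod (f := fun _ : Fin n => fun t : ℝ => t ^ (ε - 1)) fun _ => h1

/-- `x ↦ max_A x^p` is measurable. [folklore] -/
private theorem measurable_tropMax (A : Finset (Fin n → ℝ)) (hA : A.Nonempty) :
    Measurable (tropMax A hA) := by
  have : tropMax A hA = A.sup' hA fun p => fun x => rmonom p x := by
    funext x; simp [tropMax, Finset.sup'_apply]
  rw [this]
  refine Finset.measurable_sup' hA fun p _ => ?_
  unfold rmonom
  exact Finset.measurable_prod _ fun i _ => (measurable_pi_apply i).pow_const _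

/-- **The tropical ray criterion** (App. A with the polynomials replaced by their tropical maxima): if
`min_{p∈A}⟨p,β⟩ + Σβ − min_{q∈B}⟨q,β⟩ > 0` for every non-zero `β ≥ 0` then `max_A x^p / max_B x^q` is integrable on `(0,1)ⁿ`.
[cite: Volkov2016, App. A (p.1185)] -/
theorem integrableOn_tropMax_div (A B : Finset (Fin n → ℝ)) (hA : A.Nonempty) (hB : B.Nonempty)
    (hpos : ∀ β : Fin n → ℝ, (∀ i, 0 ≤ β i) → β ≠ 0 → 0 < rayExp A B hA hB β) :
    IntegrableOn (fun x => tropMax A hA x / tropMax B hB x) (unitCube n) volume := by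
  obtain ⟨ε, hε, hbound⟩ := exists_uniform_rayExp A B hA hB hpos
  refine Integrable.mono' (integrableOn_prod_rpow hε)
    ((measurable_tropMax A hA).div (measurable_tropMax B hB)).aestronglyMeasurable ?_
  refine ae_restrict_of_forall_mem measurableSet_unitCube fun x hx => ?_
  have hx0 : ∀ i, 0 < x i := fun i => ((mem_unitCube.1 hx) i).1
  rw [Real.norm_eq_abs, abs_of_nonneg (div_nonneg (tropMax_pos A hA hx0).le (tropMax_pos B hB hx0).le)]
  exact tropMax_div_le_prod_rpow A B hA hB hbound hx

/-- Any a.e.-strongly-measurable `f` with `|f| ≤ K · max_A x^p / max_B x^q` on the open cube is integrable there, under the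
exponent condition — the form in which the criterion applies to a numerator bounded by its monomials over ANY denominator bounded
below by a constant times its tropical maximum. [cite: Volkov2016, App. A (p.1185)] -/
theorem integrableOn_of_le_tropMax_div (A B : Finset (Fin n → ℝ)) (hA : A.Nonempty)
    (hB : B.Nonempty)
    (hpos : ∀ β : Fin n → ℝ, (∀ i, 0 ≤ β i) → β ≠ 0 → 0 < rayExp A B hA hB β)
    {f : (Fin n → ℝ) → ℝ} (hf : AEStronglyMeasurable f (volume.restrict (unitCube n)))
    {K : ℝ} (hK : ∀ x ∈ unitCube n, |f x| ≤ K * (tropMax A hA x / tropMax B hB x)) :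
    IntegrableOn f (unitCube n) volume := by
  refine Integrable.mono' ((integrableOn_tropMax_div A B hA hB hpos).const_mul K) hf ?_
  exact ae_restrict_of_forall_mem measurableSet_unitCube fun x hx => by
    rw [Real.norm_eq_abs]; exact hK x hx


/-! ### §2 The polynomial layer: quotients `P/Q` with a positive-coefficient denominator -/

open MvPolynomial

/-- The real exponent vector of a multi-index. [folklore] -/
def castExp (p : Fin n →₀ ℕ) : Fin n → ℝ := fun i => (p i : ℝ)

/-- The exponent set of a polynomial: its support, as real vectors (App. A's «различные векторы» l, s). [cite: Volkov2016, App. A (p.1185)] -/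
def exps (P : MvPolynomial (Fin n) ℝ) : Finset (Fin n → ℝ) := P.support.image castExp

/-- A non-zero polynomial has a non-empty exponent set. [folklore] -/
private theorem exps_nonempty {P : MvPolynomial (Fin n) ℝ} (hP : P ≠ 0) : (exps P).Nonempty :=
  (Finset.image_nonempty).2 (support_nonempty.2 hP)

/-- Volkov's order of a polynomial along the ray `β`: `min_{p ∈ supp P} ⟨p, β⟩`, the power of `δ` carried by `P(c δ^β)`
(junk value `0` for `P = 0`, documented). [cite: Volkov2016, §5.1 (19)–(20) with App. A (p.1185)] -/
def rayOrder (P : MvPolynomial (Fin n) ℝ) (β : Fin n → ℝ) : ℝ :=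
  if h : P = 0 then 0 else tropOrd (exps P) (exps_nonempty h) β

/-- The ray exponent of `I(z) · z₁⋯z_n` for `I = P/Q` along `z = δ^β`: `rayOrder P β + Σβ − rayOrder Q β` — the quantity whose
positivity on every ray is (20) for a positive-coefficient `Q`. [cite: Volkov2016, §5.1 (20) with App. A (p.1185)] -/
def rayExponent (P Q : MvPolynomial (Fin n) ℝ) (β : Fin n → ℝ) : ℝ :=
  rayOrder P β + ∑ i, β i - rayOrder Q β

/-- `rayOrder` of a non-zero polynomial is the tropical order of its exponent set. [folklore] -/
private theorem rayOrder_of_ne_zero {P : MvPolynomial (Fin n) ℝ} (hP : P ≠ 0) (β : Fin n → ℝ) :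
    rayOrder P β = tropOrd (exps P) (exps_nonempty hP) β := by
  simp [rayOrder, hP]

/-- `rayOrder P β = min_{p ∈ supp P} ⟨p, β⟩`. [cite: Volkov2016, App. A (p.1185)] -/
theorem rayOrder_eq_inf' {P : MvPolynomial (Fin n) ℝ} (hP : P ≠ 0) (β : Fin n → ℝ) :
    rayOrder P β = P.support.inf' (support_nonempty.2 hP) fun p => linPair (castExp p) β := by
  rw [rayOrder_of_ne_zero hP]
  unfold tropOrd exps
  refine le_antisymm (Finset.le_inf' _ _ fun p hp =>
    Finset.inf'_le (fun p => linPair p β) (Finset.mem_image_of_mem castExp hp))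
    (Finset.le_inf' _ _ fun q hq => ?_)
  obtain ⟨p, hp, rfl⟩ := Finset.mem_image.1 hq
  exact Finset.inf'_le (fun p => linPair (castExp p) β) hp

/-- Every monomial of `P` has order `≥ rayOrder P β` along `β`. [folklore] -/
private theorem rayOrder_le {P : MvPolynomial (Fin n) ℝ} {p : Fin n →₀ ℕ} (hp : p ∈ P.support)
    (β : Fin n → ℝ) : rayOrder P β ≤ linPair (castExp p) β := by
  have hP : P ≠ 0 := support_nonempty.1 ⟨p, hp⟩
  rw [rayOrder_eq_inf' hP]
  exact Finset.inf'_le _ hp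

/-- The order is attained by some monomial. [folklore] -/
private theorem exists_rayOrder_eq {P : MvPolynomial (Fin n) ℝ} (hP : P ≠ 0) (β : Fin n → ℝ) :
    ∃ p ∈ P.support, linPair (castExp p) β = rayOrder P β := by
  obtain ⟨p, hp, h⟩ := Finset.exists_mem_eq_inf' (support_nonempty.2 hP)
    fun p => linPair (castExp p) β
  exact ⟨p, hp, by rw [rayOrder_eq_inf' hP, h]⟩

/-- For non-zero `P`, `Q` the polynomial ray exponent is the tropical one of their exponent sets. [folklore] -/
private theorem rayExponent_of_ne_zero {P Q : MvPolynomial (Fin n) ℝ} (hP : P ≠ 0) (hQ : Q ≠ 0)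
    (β : Fin n → ℝ) :
    rayExponent P Q β = rayExp (exps P) (exps Q) (exps_nonempty hP) (exps_nonempty hQ) β := by
  simp [rayExponent, rayExp, rayOrder_of_ne_zero hP, rayOrder_of_ne_zero hQ]

/-- The monomial `Π_i x_i^{p_i}` of a multi-index is the real-exponent monomial of `castExp p`. [folklore] -/
private theorem prod_pow_eq_rmonom (p : Fin n →₀ ℕ) (x : Fin n → ℝ) :
    ∏ i, x i ^ (p i) = rmonom (castExp p) x := by
  simp [rmonom, castExp, Real.rpow_natCast]

/-- `|P(x)| ≤ (Σ_p |coeff_p|) · max_{supp P} x^p` on the positive orthant (cf. Borinsky 2020 Thm 8a).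
[folklore] -/
private theorem abs_eval_le (P : MvPolynomial (Fin n) ℝ) (hP : P ≠ 0) {x : Fin n → ℝ}
    (hx : ∀ i, 0 < x i) :
    |eval x P| ≤ (∑ p ∈ P.support, |P.coeff p|) * tropMax (exps P) (exps_nonempty hP) x := by
  rw [eval_eq', Finset.sum_mul]
  refine (Finset.abs_sum_le_sum_abs _ _).trans (Finset.sum_le_sum fun p hp => ?_)
  rw [abs_mul, prod_pow_eq_rmonom, abs_of_nonneg (rmonom_pos hx _).le]
  refine mul_le_mul_of_nonneg_left ?_ (abs_nonneg _)
  exact Finset.le_sup' (fun q => rmonom q x) (Finset.mem_image_of_mem _ hp)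

/-- A positive-coefficient `Q` dominates `(min_q coeff_q) · max_{supp Q} x^q` on the positive orthant — App. A's
«D₁,…,D_p > 0» regions `Φ_j` in one line (cf. Borinsky 2020's "trivial special case" of Thm 8b). [cite: Volkov2016, App. A (p.1185)] -/
private theorem le_eval_of_coeff_pos (Q : MvPolynomial (Fin n) ℝ) (hQ0 : Q ≠ 0)
    (hQ : ∀ q ∈ Q.support, 0 < Q.coeff q) {x : Fin n → ℝ} (hx : ∀ i, 0 < x i) :
    (Q.support.inf' (support_nonempty.2 hQ0) fun q => Q.coeff q)
      * tropMax (exps Q) (exps_nonempty hQ0) x ≤ eval x Q := by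
  obtain ⟨q, hq, hqeq⟩ := Finset.exists_mem_eq_sup' (exps_nonempty hQ0) fun q => rmonom q x
  simp only [exps, Finset.mem_image] at hq
  obtain ⟨q, hq, rfl⟩ := hq
  unfold tropMax
  rw [hqeq, ← prod_pow_eq_rmonom, eval_eq']
  calc (Q.support.inf' _ fun q => Q.coeff q) * ∏ i, x i ^ q i
      ≤ Q.coeff q * ∏ i, x i ^ q i :=
        mul_le_mul_of_nonneg_right (Finset.inf'_le _ hq)
          (Finset.prod_nonneg fun i _ => pow_nonneg (hx i).le _)
    _ ≤ ∑ d ∈ Q.support, Q.coeff d * ∏ i, x i ^ d i :=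
        Finset.single_le_sum (fun d hd => mul_nonneg (hQ d hd).le
          (Finset.prod_nonneg fun i _ => pow_nonneg (hx i).le _)) hq

/-- **The exponent form of Утв. 1**: for a quotient of real polynomials whose denominator has positive coefficients, if
`min_{supp P}⟨p,β⟩ + Σβ − min_{supp Q}⟨q,β⟩ > 0` for every non-zero `β ≥ 0`, then `P/Q` is integrable on the unit cube
(`|P| ≤ Σ|coeff|·max`, `Q ≥ min coeff·max`, then the tropical criterion). [cite: Volkov2016, §5.1 Утв. 1 (p.1175) with App. A (p.1185)] -/
theorem integrableOn_div_of_rayExponent_pos (P Q : MvPolynomial (Fin n) ℝ)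
    (hQ : ∀ q ∈ Q.support, 0 < Q.coeff q)
    (hpos : ∀ β : Fin n → ℝ, (∀ i, 0 ≤ β i) → β ≠ 0 → 0 < rayExponent P Q β) :
    IntegrableOn (fun x => eval x P / eval x Q) (unitCube n) volume := by
  by_cases hP : P = 0
  · simp [hP]
  by_cases hQ0 : Q = 0
  · simp [hQ0]
  have hA := exps_nonempty hP
  have hB := exps_nonempty hQ0
  set cQ : ℝ := Q.support.inf' (support_nonempty.2 hQ0) fun q => Q.coeff q with hcQ
  have hcQpos : 0 < cQ := by
    obtain ⟨q, hq, h⟩ := Finset.exists_mem_eq_inf' (support_nonempty.2 hQ0) fun q => Q.coeff q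
    rw [hcQ, h]; exact hQ q hq
  set SP : ℝ := ∑ p ∈ P.support, |P.coeff p|
  refine integrableOn_of_le_tropMax_div (exps P) (exps Q) hA hB
    (fun β hβ hβ0 => by simpa [rayExponent_of_ne_zero hP hQ0] using hpos β hβ hβ0)
    ((MvPolynomial.continuous_eval P).measurable.div
      (MvPolynomial.continuous_eval Q).measurable).aestronglyMeasurable (K := SP / cQ) ?_
  intro x hx
  have hx0 : ∀ i, 0 < x i := fun i => ((mem_unitCube.1 hx) i).1
  have hQx : cQ * tropMax (exps Q) hB x ≤ eval x Q := le_eval_of_coeff_pos Q hQ0 hQ hx0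
  have hden : 0 < cQ * tropMax (exps Q) hB x := mul_pos hcQpos (tropMax_pos _ hB hx0)
  have hQpos : 0 < eval x Q := lt_of_lt_of_le hden hQx
  rw [abs_div, abs_of_pos hQpos, ← mul_div_mul_comm]
  exact div_le_div₀ (mul_nonneg (Finset.sum_nonneg fun p _ => abs_nonneg _) (tropMax_pos _ hA hx0).le)
    (abs_eval_le P hP hx0) hden hQx


/-! ### §3 From the printed ray hypothesis to the exponent condition (the rest of App. A) -/

/-- The initial form of `R` along `β`: the part of `R` on the monomials of minimal order `⟨r, β⟩ = rayOrder R β`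
(App. A: «выберем все q, для которых произведение (l_q − s_j) r максимально, пусть … это 1, 2, …, H»).
[cite: Volkov2016, App. A (p.1185)] -/
def initForm (R : MvPolynomial (Fin n) ℝ) (β : Fin n → ℝ) : MvPolynomial (Fin n) ℝ :=
  ∑ r ∈ R.support with linPair (castExp r) β = rayOrder R β, monomial r (R.coeff r)

/-- Coefficients of the initial form: `R`'s on the monomials of minimal order, `0` elsewhere. [cite: Volkov2016, App. A (p.1185)] -/
theorem coeff_initForm (R : MvPolynomial (Fin n) ℝ) (β : Fin n → ℝ) (s : Fin n →₀ ℕ) :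
    coeff s (initForm R β)
      = if linPair (castExp s) β = rayOrder R β then coeff s R else 0 := by
  classical
  unfold initForm
  rw [coeff_sum]
  simp only [coeff_monomial]
  rw [Finset.sum_ite_eq']
  simp only [Finset.mem_filter, mem_support_iff]
  by_cases h : linPair (castExp s) β = rayOrder R β
  · by_cases h0 : coeff s R = 0
    · simp [h, h0]
    · simp [h, h0]
  · simp [h]

/-- On the minimal face the initial form has `R`'s coefficients. [folklore] -/
private theorem coeff_initForm_of_eq (R : MvPolynomial (Fin n) ℝ) (β : Fin n → ℝ) {r : Fin n →₀ ℕ}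
    (h : linPair (castExp r) β = rayOrder R β) : coeff r (initForm R β) = coeff r R := by
  rw [coeff_initForm, if_pos h]

/-- The support of the initial form = the monomials of minimal order (App. A's indices `1, …, H`).
[cite: Volkov2016, App. A (p.1185)] -/
theorem support_initForm (R : MvPolynomial (Fin n) ℝ) (β : Fin n → ℝ) :
    (initForm R β).support = R.support.filter fun r => linPair (castExp r) β = rayOrder R β := by
  ext s
  rw [mem_support_iff, coeff_initForm, Finset.mem_filter, mem_support_iff]
  by_cases h : linPair (castExp s) β = rayOrder R β <;> simp [h]

/-- The initial form of a non-zero polynomial is non-zero (App. A's top group 1,…,H is non-empty). [cite: Volkov2016, App. A (p.1185)] -/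
theorem initForm_ne_zero {R : MvPolynomial (Fin n) ℝ} (hR : R ≠ 0) (β : Fin n → ℝ) :
    initForm R β ≠ 0 := by
  obtain ⟨r, hr, h⟩ := exists_rayOrder_eq hR β
  exact ne_zero_iff.2 ⟨r, by rw [coeff_initForm_of_eq R β h]; exact mem_support_iff.1 hr⟩

/-- Evaluation of the initial form: the sum over the monomials of minimal order (App. A's `C₁e^{(l₁−s_j)y⁰} + … + C_H e^{(l_H−s_j)y⁰}`).
[cite: Volkov2016, App. A (p.1185)] -/
theorem eval_initForm (R : MvPolynomial (Fin n) ℝ) (β : Fin n → ℝ) (c : Fin n → ℝ) :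
    eval c (initForm R β) = ∑ r ∈ R.support with linPair (castExp r) β = rayOrder R β,
      R.coeff r * ∏ i, c i ^ r i := by
  rw [eval_eq', support_initForm]
  exact Finset.sum_congr rfl fun r hr => by rw [coeff_initForm_of_eq R β (Finset.mem_filter.1 hr).2]

/-- The initial form of a positive-coefficient `Q ≠ 0` is positive on the positive orthant. [folklore] -/
private theorem eval_initForm_pos (Q : MvPolynomial (Fin n) ℝ) (hQ0 : Q ≠ 0)
    (hQ : ∀ q ∈ Q.support, 0 < Q.coeff q) (β : Fin n → ℝ) {c : Fin n → ℝ} (hc : ∀ i, 0 < c i) :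
    0 < eval c (initForm Q β) := by
  rw [eval_initForm]
  obtain ⟨q, hq, h⟩ := exists_rayOrder_eq hQ0 β
  refine Finset.sum_pos (fun r hr => ?_) ⟨q, Finset.mem_filter.2 ⟨hq, h⟩⟩
  exact mul_pos (hQ r (Finset.mem_filter.1 hr).1) (Finset.prod_pos fun i _ => pow_pos (hc i) _)

/-- **App. A's generic point** «Выберем такое y⁰, что C₁ exp((l₁ − s_j)y⁰) + … + C_H exp((l_H − s_j)y⁰) ≠ 0 (такое значение
существует, так как все l₁,…,l_H различны …)»: a non-zero real polynomial does not vanish identically on the open unit cube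
(Mathlib's combinatorial-Nullstellensatz lemma `MvPolynomial.eq_zero_of_eval_zero_at_prod_finset` on the grid `{1/(k+2)}`).
[cite: Volkov2016, App. A (p.1185)] -/
theorem exists_eval_ne_zero_of_ne_zero (F : MvPolynomial (Fin n) ℝ) (hF : F ≠ 0) :
    ∃ c : Fin n → ℝ, (∀ i, c i ∈ Set.Ioo (0 : ℝ) 1) ∧ eval c F ≠ 0 := by
  classical
  let g : ℕ → ℝ := fun k => 1 / ((k : ℝ) + 2)
  have hinj : Function.Injective g := by
    intro a b h
    have h' : (a : ℝ) + 2 = (b : ℝ) + 2 := by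
      have ha : (a : ℝ) + 2 ≠ 0 := by positivity
      have hb : (b : ℝ) + 2 ≠ 0 := by positivity
      simp only [g] at h
      field_simp at h
      linarith
    exact_mod_cast (add_right_cancel h')
  let S : Fin n → Finset ℝ := fun i => (Finset.range (F.degreeOf i + 1)).image g
  have hcard : ∀ i, F.degreeOf i < (S i).card := fun i => by
    simp [S, Finset.card_image_of_injective _ hinj]
  have hS : ∀ i, ∀ t ∈ S i, t ∈ Set.Ioo (0 : ℝ) 1 := by
    intro i t ht
    simp only [S, Finset.mem_image, Finset.mem_range] at ht
    obtain ⟨k, -, rfl⟩ := ht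
    have hk : (0 : ℝ) < (k : ℝ) + 2 := by positivity
    refine ⟨by positivity, ?_⟩
    rw [div_lt_one hk]
    linarith
  by_contra h
  push Not at h
  exact hF (eq_zero_of_eval_zero_at_prod_finset F S hcard fun x hx => h x fun i => hS i _ (hx i))

/-- Along the monomial path `z_i = c_i δ^{β_i}`: `R(z(δ)) = Σ_r coeff_r · c^r · δ^{⟨r,β⟩}` (`δ > 0`) — App. A's rewriting of a polynomial as
«C₁ exp(l₁y) + … + C_h exp(l_h y)» after `z = e^{−y}`, read along one ray. [cite: Volkov2016, App. A (p.1185)] -/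
theorem eval_rayPath (R : MvPolynomial (Fin n) ℝ) (β c : Fin n → ℝ) {δ : ℝ} (hδ : 0 < δ) :
    eval (fun i => c i * δ ^ β i) R
      = ∑ r ∈ R.support, R.coeff r * (∏ i, c i ^ r i) * δ ^ linPair (castExp r) β := by
  rw [eval_eq']
  refine Finset.sum_congr rfl fun r _ => ?_
  rw [mul_assoc]
  congr 1
  simp only [mul_pow, Finset.prod_mul_distrib]
  congr 1
  rw [linPair, Real.rpow_sum_of_pos hδ]
  refine Finset.prod_congr rfl fun i _ => ?_
  rw [← Real.rpow_natCast, ← Real.rpow_mul hδ.le, castExp, mul_comm]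

/-- `δ^s → 0` as `δ → 0⁺` for `s > 0`. [folklore] -/
private theorem tendsto_rpow_nhdsGT_zero {s : ℝ} (hs : 0 < s) :
    Tendsto (fun δ : ℝ => δ ^ s) (𝓝[>] 0) (𝓝 0) := by
  have h := (Real.continuousAt_rpow_const 0 s (Or.inr hs.le)).tendsto
  simp only [Real.zero_rpow hs.ne'] at h
  exact tendsto_nhdsWithin_of_tendsto_nhds h

/-- The leading asymptotics along a ray: `δ^{−rayOrder R β} · R(c δ^β) → (initForm R β)(c)` as `δ → 0⁺` (App. A: along the ray the
top group carries the common factor and «не будет стремиться к нулю»). [cite: Volkov2016, App. A (p.1185)] -/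
theorem tendsto_rpow_neg_rayOrder_mul_eval (R : MvPolynomial (Fin n) ℝ) (β c : Fin n → ℝ) :
    Tendsto (fun δ : ℝ => δ ^ (-rayOrder R β) * eval (fun i => c i * δ ^ β i) R) (𝓝[>] 0)
      (𝓝 (eval c (initForm R β))) := by
  have hev : (fun δ : ℝ => δ ^ (-rayOrder R β) * eval (fun i => c i * δ ^ β i) R) =ᶠ[𝓝[>] 0]
      fun δ => ∑ r ∈ R.support,
        R.coeff r * (∏ i, c i ^ r i) * δ ^ (linPair (castExp r) β - rayOrder R β) := by
    filter_upwards [self_mem_nhdsWithin] with δ (hδ : 0 < δ)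
    rw [eval_rayPath R β c hδ, Finset.mul_sum]
    refine Finset.sum_congr rfl fun r _ => ?_
    rw [sub_eq_add_neg, Real.rpow_add hδ]
    ring
  refine (tendsto_congr' hev).2 ?_
  rw [eval_initForm, Finset.sum_filter]
  refine tendsto_finsetSum _ fun r hr => ?_
  by_cases h : linPair (castExp r) β = rayOrder R β
  · rw [if_pos h]
    have hfun : (fun δ : ℝ => R.coeff r * (∏ i, c i ^ r i) * δ ^ (linPair (castExp r) β - rayOrder R β))
        = fun _ => R.coeff r * ∏ i, c i ^ r i := by
      funext δ; rw [h, sub_self, Real.rpow_zero, mul_one]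
    rw [hfun]
    exact tendsto_const_nhds
  · rw [if_neg h]
    have hle : rayOrder R β ≤ linPair (castExp r) β := rayOrder_le hr β
    have hlt : 0 < linPair (castExp r) β - rayOrder R β := by
      rcases hle.lt_or_eq with hlt | heq
      · linarith
      · exact absurd heq.symm h
    have := (tendsto_rpow_nhdsGT_zero hlt).const_mul (R.coeff r * ∏ i, c i ^ r i)
    simpa using this


/-- The monomial power path of direction `β` through `c`: `z_i(δ) = c_i δ^{β_i}` — App. A's «z_q(δ) = exp(−y⁰_q) δ^{r_q}».
[cite: Volkov2016, App. A (p.1185)] -/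
def rayPath (c β : Fin n → ℝ) (δ : ℝ) : Fin n → ℝ := fun i => c i * δ ^ β i

/-- **App. A's final step** «…можно положить β = r, z_q(δ) = exp(−y⁰_q) δ^{r_q} и получить противоречие с условием утверждения»:
if `P(z)/Q(z) · z₁⋯z_n → 0` along every monomial path of direction `β` based in the open cube, then the ray exponent at `β` is
positive (`P ≠ 0`, `Q ≠ 0` with positive coefficients). Proof: at a generic base point `c` the rescaled function
`(P/Q · Πz)(δ) · δ^{−e}` tends both to `0` (if `e ≤ 0`, `δ^{−e} ≤ 1`) and to `P_β(c)/Q_β(c) · Πc ≠ 0`.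
[cite: Volkov2016, App. A (p.1185)] -/
theorem rayExponent_pos_of_tendsto_zero {P Q : MvPolynomial (Fin n) ℝ} (hP : P ≠ 0) (hQ0 : Q ≠ 0)
    (hQ : ∀ q ∈ Q.support, 0 < Q.coeff q) {β : Fin n → ℝ}
    (hray : ∀ c : Fin n → ℝ, (∀ i, c i ∈ Set.Ioo (0 : ℝ) 1) →
      Tendsto (fun δ : ℝ => eval (rayPath c β δ) P / eval (rayPath c β δ) Q * ∏ i, rayPath c β δ i)
        (𝓝[>] 0) (𝓝 0)) :
    0 < rayExponent P Q β := by
  by_contra hle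
  push Not at hle
  obtain ⟨c, hc, hPc⟩ := exists_eval_ne_zero_of_ne_zero (initForm P β) (initForm_ne_zero hP β)
  have hc0 : ∀ i, 0 < c i := fun i => (hc i).1
  have hQc : 0 < eval c (initForm Q β) := eval_initForm_pos Q hQ0 hQ β hc0
  have hcprod : 0 < ∏ i, c i := Finset.prod_pos fun i _ => hc0 i
  -- (1) the printed hypothesis times the bounded factor `δ^{-e}`, `e ≤ 0`, still tends to `0`
  have h1 : Tendsto (fun δ : ℝ => (eval (rayPath c β δ) P / eval (rayPath c β δ) Q
      * ∏ i, rayPath c β δ i) * δ ^ (-rayExponent P Q β)) (𝓝[>] 0) (𝓝 0) := by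
    refine squeeze_zero_norm' ?_ (tendsto_zero_iff_norm_tendsto_zero.1 (hray c hc))
    filter_upwards [Ioo_mem_nhdsGT (zero_lt_one' ℝ)] with δ hδ
    rw [norm_mul, Real.norm_of_nonneg (Real.rpow_nonneg hδ.1.le _)]
    exact mul_le_of_le_one_right (norm_nonneg _)
      (Real.rpow_le_one hδ.1.le hδ.2.le (neg_nonneg.2 hle))
  -- (2) the same function, regrouped, tends to `P_β(c)/Q_β(c) · Π c ≠ 0`
  have h2 : Tendsto (fun δ : ℝ => δ ^ (-rayOrder P β) * eval (rayPath c β δ) P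
      / (δ ^ (-rayOrder Q β) * eval (rayPath c β δ) Q) * ∏ i, c i) (𝓝[>] 0)
      (𝓝 (eval c (initForm P β) / eval c (initForm Q β) * ∏ i, c i)) :=
    ((tendsto_rpow_neg_rayOrder_mul_eval P β c).div
      (tendsto_rpow_neg_rayOrder_mul_eval Q β c) hQc.ne').mul_const _
  have h12 : (fun δ : ℝ => (eval (rayPath c β δ) P / eval (rayPath c β δ) Q
      * ∏ i, rayPath c β δ i) * δ ^ (-rayExponent P Q β)) =ᶠ[𝓝[>] 0]
      fun δ => δ ^ (-rayOrder P β) * eval (rayPath c β δ) P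
        / (δ ^ (-rayOrder Q β) * eval (rayPath c β δ) Q) * ∏ i, c i := by
    filter_upwards [self_mem_nhdsWithin] with δ (hδ : 0 < δ)
    have hprod : ∏ i, rayPath c β δ i = (∏ i, c i) * δ ^ ∑ i, β i := by
      simp only [rayPath, Finset.prod_mul_distrib, Real.rpow_sum_of_pos hδ]
    have hexp : δ ^ (∑ i, β i) * δ ^ (-rayExponent P Q β)
        = δ ^ (-rayOrder P β) / δ ^ (-rayOrder Q β) := by
      rw [← Real.rpow_add hδ, ← Real.rpow_sub hδ]
      congr 1
      simp only [rayExponent]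
      ring
    rw [hprod, mul_div_mul_comm, ← hexp]
    ring
  have h0 := tendsto_nhds_unique (h1.congr' h12) h2
  exact (mul_ne_zero (div_ne_zero hPc hQc.ne') hcprod.ne') h0.symm

/-- **Volkov's convergence criterion for integrals of fractional-rational functions**
([Volkov2016] §5.1 Утверждение 1 = JETP Prop. 1, proof App. A), in a form STRONGER than printed:
it suffices that `I(z(δ)) z₁(δ)⋯z_n(δ) → 0` along the MONOMIAL paths `z_i(δ) = c_i δ^{β_i}`
(`c ∈ (0,1)ⁿ`, `β ≥ 0`, `β ≠ 0`); then `I = P/Q` is integrable over the unit cube.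
[cite: Volkov2016, §5.1 Утв. 1 (p.1175) and App. A (p.1185)] -/
theorem integrableOn_div_of_tendsto_zero_along_rays (P Q : MvPolynomial (Fin n) ℝ)
    (hQ : ∀ q ∈ Q.support, 0 < Q.coeff q)
    (hray : ∀ β : Fin n → ℝ, (∀ i, 0 ≤ β i) → β ≠ 0 → ∀ c : Fin n → ℝ,
      (∀ i, c i ∈ Set.Ioo (0 : ℝ) 1) →
      Tendsto (fun δ : ℝ => eval (rayPath c β δ) P / eval (rayPath c β δ) Q * ∏ i, rayPath c β δ i)
        (𝓝[>] 0) (𝓝 0)) :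
    IntegrableOn (fun x => eval x P / eval x Q) (unitCube n) volume := by
  by_cases hP : P = 0
  · simp [hP]
  by_cases hQ0 : Q = 0
  · simp [hQ0]
  exact integrableOn_div_of_rayExponent_pos P Q hQ fun β hβ hβ0 =>
    rayExponent_pos_of_tendsto_zero hP hQ0 hQ (hray β hβ hβ0)

/-- **Утверждение 1 verbatim** ([Volkov2016] §5.1, p.1175): "Let `I(z₁,…,z_n)` be a quotient of two
polynomials whose denominator has positive coefficients. If for every vector of non-negative
numbers `β = (β₁,…,β_n)` with `β₁ + … + β_n > 0` and for functions `z₁(δ),…,z_n(δ)`, defined for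
`δ > 0` and taking values in `(0;1]`, such that `z₁ ≍ δ^{β₁}, …, z_n ≍ δ^{β_n}` (19) as `δ → 0`
[footnote 16: `f ≍ g` means `0 < C₁ < |f(δ)/g(δ)| < C₂` in some neighbourhood of the limit value
of `δ`], one has `I(z₁(δ),…,z_n(δ)) z₁(δ)⋯z_n(δ) → 0` (20), then the integral
`∫₀¹ |I(z₁,…,z_n)| dz₁…dz_n` is finite."  Typed with Mathlib's `=Θ[𝓝[>] 0]` for `≍` and
`IntegrableOn` on the open unit cube (= the closed cube up to a null set) for "the integral of |I|
is finite". [cite: Volkov2016, §5.1 Утв. 1 (Prop. 1), proof App. A] -/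
theorem integrableOn_div_of_isTheta_paths (P Q : MvPolynomial (Fin n) ℝ)
    (hQ : ∀ q ∈ Q.support, 0 < Q.coeff q)
    (hray : ∀ β : Fin n → ℝ, (∀ i, 0 ≤ β i) → 0 < ∑ i, β i → ∀ z : ℝ → (Fin n → ℝ),
      (∀ δ, 0 < δ → ∀ i, z δ i ∈ Set.Ioc (0 : ℝ) 1) →
      (∀ i, (fun δ => z δ i) =Θ[𝓝[>] 0] fun δ => δ ^ β i) →
      Tendsto (fun δ : ℝ => eval (z δ) P / eval (z δ) Q * ∏ i, z δ i) (𝓝[>] 0) (𝓝 0)) :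
    IntegrableOn (fun x => eval x P / eval x Q) (unitCube n) volume := by
  refine integrableOn_div_of_tendsto_zero_along_rays P Q hQ fun β hβ hβ0 c hc => ?_
  have hsum : 0 < ∑ i, β i := by
    obtain ⟨i, hi⟩ : ∃ i, β i ≠ 0 := by
      by_contra h
      push Not at h
      exact hβ0 (funext h)
    exact Finset.sum_pos' (fun i _ => hβ i) ⟨i, Finset.mem_univ i, (hβ i).lt_of_ne hi.symm⟩
  -- the clipped path `z_i(δ) = c_i (min δ 1)^{β_i}` lives in `(0,1]` for all `δ > 0` and agrees
  -- with the monomial path on `(0,1)`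
  set z : ℝ → (Fin n → ℝ) := fun δ i => c i * min δ 1 ^ β i with hz
  have hzval : ∀ δ, 0 < δ → ∀ i, z δ i ∈ Set.Ioc (0 : ℝ) 1 := by
    intro δ hδ i
    have hm0 : 0 < min δ 1 := lt_min hδ one_pos
    have hm1 : min δ 1 ≤ 1 := min_le_right _ _
    refine ⟨mul_pos (hc i).1 (Real.rpow_pos_of_pos hm0 _), ?_⟩
    exact mul_le_one₀ (hc i).2.le (Real.rpow_nonneg hm0.le _) (Real.rpow_le_one hm0.le hm1 (hβ i))
  have heq : ∀ᶠ δ in 𝓝[>] (0 : ℝ), z δ = rayPath c β δ := by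
    filter_upwards [Ioo_mem_nhdsGT (zero_lt_one' ℝ)] with δ hδ
    funext i
    simp [hz, rayPath, min_eq_left hδ.2.le]
  have htheta : ∀ i, (fun δ => z δ i) =Θ[𝓝[>] 0] fun δ => δ ^ β i := by
    intro i
    have h1 : (fun δ => z δ i) =ᶠ[𝓝[>] 0] fun δ => c i * δ ^ β i :=
      heq.mono fun δ hδ => by simp only [hδ, rayPath]
    exact h1.trans_isTheta ((Asymptotics.isTheta_const_mul_left (hc i).1.ne').2
      Asymptotics.isTheta_rfl)
  refine (hray β hβ hsum z hzval htheta).congr' ?_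
  exact heq.mono fun δ hδ => by simp only [hδ]


/-- The open unit cube and the closed one `[0,1]ⁿ = Icc 0 1` of the printed `∫₀¹ … dz₁…dz_n` differ by a Lebesgue-null set.
[cite: Volkov2016, §5.1 Утв. 1 (p.1175)] -/
theorem unitCube_ae_eq_Icc : unitCube n =ᵐ[volume] Set.Icc (0 : Fin n → ℝ) 1 := by
  rw [volume_pi]
  exact Measure.univ_pi_Ioo_ae_eq_Icc (f := fun _ => (0 : ℝ)) (g := fun _ => (1 : ℝ))

/-- Integrability on the closed unit cube `[0,1]ⁿ` of the printed statement is the same as on the open one.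
[cite: Volkov2016, §5.1 Утв. 1 (p.1175)] -/
theorem integrableOn_Icc_iff_unitCube {f : (Fin n → ℝ) → ℝ} :
    IntegrableOn f (Set.Icc (0 : Fin n → ℝ) 1) volume ↔ IntegrableOn f (unitCube n) volume :=
  ⟨fun h => h.congr_set_ae unitCube_ae_eq_Icc, fun h => h.congr_set_ae unitCube_ae_eq_Icc.symm⟩

/-- **Утверждение 1 with the printed domain** `∫₀¹ … dz₁…dz_n`: under the verbatim hypotheses, `P/Q` is integrable on the CLOSED
unit cube `[0,1]ⁿ`. [cite: Volkov2016, §5.1 Утв. 1 (Prop. 1, p.1175), proof App. A (p.1185)] -/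
theorem integrableOn_Icc_div_of_isTheta_paths (P Q : MvPolynomial (Fin n) ℝ)
    (hQ : ∀ q ∈ Q.support, 0 < Q.coeff q)
    (hray : ∀ β : Fin n → ℝ, (∀ i, 0 ≤ β i) → 0 < ∑ i, β i → ∀ z : ℝ → (Fin n → ℝ),
      (∀ δ, 0 < δ → ∀ i, z δ i ∈ Set.Ioc (0 : ℝ) 1) →
      (∀ i, (fun δ => z δ i) =Θ[𝓝[>] 0] fun δ => δ ^ β i) →
      Tendsto (fun δ : ℝ => eval (z δ) P / eval (z δ) Q * ∏ i, z δ i) (𝓝[>] 0) (𝓝 0)) :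
    IntegrableOn (fun x => eval x P / eval x Q) (Set.Icc (0 : Fin n → ℝ) 1) volume :=
  integrableOn_Icc_iff_unitCube.2 (integrableOn_div_of_isTheta_paths P Q hQ hray)

/-! ### §4 Dictionary with `Borinsky2020/TropicalApproximation.lean` (nothing re-declared there is re-proved here beyond these identifications) -/

/-- On every point, the real-exponent tropical maximum of a non-zero polynomial's exponent set IS Borinsky's tropical
approximation `p^tr(x) = max_{ℓ∈supp(p)} x^ℓ` of that file (Definition 6 there). [cite: Borinsky2020, Definition 6 (tropical.tex l.399–403)] -/
theorem tropMax_exps_eq_trop (P : MvPolynomial (Fin n) ℝ) (hP : P ≠ 0) (x : Fin n → ℝ) :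
    tropMax (exps P) (exps_nonempty hP) x = Borinsky2020.trop P x := by
  have hs : P.support.Nonempty := support_nonempty.2 hP
  rw [Borinsky2020.trop, dif_pos hs]
  unfold tropMax exps
  have hmon : ∀ d : Fin n →₀ ℕ, rmonom (castExp d) x = Borinsky2020.monom d x := by
    intro d
    rw [← prod_pow_eq_rmonom, Borinsky2020.monom]
    exact (Finset.prod_subset (Finset.subset_univ _) fun i _ hi => by
      rw [Finsupp.notMem_support_iff.1 hi, pow_zero]).symm
  refine le_antisymm (Finset.sup'_le _ _ fun q hq => ?_) (Finset.sup'_le _ _ fun d hd => ?_)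
  · obtain ⟨d, hd, rfl⟩ := Finset.mem_image.1 hq
    rw [hmon]
    exact Finset.le_sup' (fun d => Borinsky2020.monom d x) hd
  · rw [← hmon]
    exact Finset.le_sup' (fun q => rmonom q x) (Finset.mem_image_of_mem castExp hd)

/-- Borinsky's pairing at `−β` is minus the ray pairing. [folklore] -/
private theorem pairing_neg_eq (β : Fin n → ℝ) (d : Fin n →₀ ℕ) :
    Borinsky2020.pairing (-β) d = -linPair (castExp d) β := by
  rw [Borinsky2020.pairing, linPair, ← Finset.sum_neg_distrib]
  have h1 : ∑ i ∈ d.support, (-β) i * (d i : ℝ) = ∑ i, (-β) i * (d i : ℝ) :=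
    Finset.sum_subset (Finset.subset_univ _) fun i _ hi => by
      rw [Finsupp.notMem_support_iff.1 hi]; simp
  rw [h1]
  exact Finset.sum_congr rfl fun i _ => by simp only [castExp, Pi.neg_apply]; ring

/-- Borinsky's face functional at `−β` is minus Volkov's ray order: `max_{supp R}⟨−β, ℓ⟩ = −min_{supp R}⟨ℓ, β⟩`.
[cite: Borinsky2020, §2 (tropical.tex l.291) «a face … maximizes a given linear functional y»] -/
theorem faceValue_neg_eq (R : MvPolynomial (Fin n) ℝ) (hR : R ≠ 0) (β : Fin n → ℝ) :
    Borinsky2020.faceValue R (-β) = -rayOrder R β := by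
  have hs : R.support.Nonempty := support_nonempty.2 hR
  rw [Borinsky2020.faceValue, dif_pos hs, rayOrder_eq_inf' hR]
  refine le_antisymm (Finset.sup'_le _ _ fun d hd => ?_) ?_
  · rw [pairing_neg_eq]; exact neg_le_neg (Finset.inf'_le _ hd)
  · obtain ⟨d, hd, h⟩ := Finset.exists_mem_eq_inf' hs fun p => linPair (castExp p) β
    rw [h, ← pairing_neg_eq]
    exact Finset.le_sup' (Borinsky2020.pairing (-β)) hd

/-- Volkov's initial form along `β` IS Borinsky's truncation `p_F` to the face exposed by the functional `−β` (Definition 1 there):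
App. A's top group «1, 2, …, H» = the face of the Newton polytope minimising `⟨·, β⟩`.
[cite: Borinsky2020, Definition 1 (tropical.tex l.302–306)] -/
theorem initForm_eq_trunc (R : MvPolynomial (Fin n) ℝ) (β : Fin n → ℝ) :
    initForm R β = Borinsky2020.trunc R (-β) := by
  classical
  by_cases hR : R = 0
  · simp [initForm, Borinsky2020.trunc, hR]
  unfold initForm Borinsky2020.trunc
  refine Finset.sum_congr (Finset.filter_congr fun d _ => ?_) fun _ _ => rfl
  rw [pairing_neg_eq, faceValue_neg_eq R hR, neg_inj]

end Literature.MathematicalPhysics.QuantumFieldTheory.Volkov2016
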